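import Mathlib
import Summits.NavierStokesRegularity.NavierStokesRegularity.Theorems.TypeIQuarterGateScarEnvelopeTypeIZoomDictionaryDefs
import Summits.NavierStokesRegularity.NavierStokesRegularity.Theorems.TypeIQuarterGateScarEnvelopeTypeIZoomDictionaryLemmas
import Summits.NavierStokesRegularity.NavierStokesRegularity.Theorems.TypeIQuarterGateScarEnvelopeTypeIZoomDictionaryUnitInputs
import Summits.NavierStokesRegularity.NavierStokesRegularity.Theorems.TypeIQuarterGateScarEnvelopeTypeIZoomDictionaryVertex
import Summits.NavierStokesRegularity.NavierStokesRegularity.Theorems.TypeIQuarterGateScarEnvelopeTypeIZoomDictionarySmallSatellites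

/-!
# Part G: large satellites — re-extraction and uniqueness of tangent flows

Part G of the plate: re-extraction and uniqueness of tangent flows for large satellites, ending in `budgetAt_iff_noSatelliteInBall`.

PROVENANCE: declaration texts VERBATIM from the HOME plates of the instrument seat nsreg-p3 (g24/g25, cell
`pub/ns-regularity-ideate`): `round-31/Tangent31prep.lean` v5 (sha16 `e5b8668e3a090216`; = ROUND-30 plate v10 + Part K) and,
for Part L, `round-32/Tangent32prep.lean` v6 (sha16 `6123f27718636121`);
the author cannot write under `Theorems/` (`perm.theorems-prover-only`); landed by the
LEAD-lineage prover ns-sz-p1 g5 on director-ns DIRECTOR-NS #218 (2), split into ≤ 400-line modules (the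
plate's `def`s gathered in `TypeIQuarterGateScarEnvelopeTypeIZoomDictionaryDefs`), namespace
`Summit.NavierStokesRegularity.NavierStokesRegularity.Cruxes.ScarEnvelopeTypeI.ZoomDictionary` (the plate's `NsregP3.R30P`), `E3` spelled out, one-line docstrings
added where the plate had none.  `--supports stmt-NavierStokesRegularity-23843 --as helper`.

HONEST FRAMING: dictionary / census TOOLING for the crux `TypeIQuarterGate.ScarEnvelopeTypeI` (item 23843):
equivalences and normal forms, kernel-checked; NO open statement is proved — 23843, its parent
`QuarterLawTypeI` (23726), the route and Navier–Stokes regularity are OPEN; hard core evaded: none.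
-/

-- the summit-side namespace repeats a component by design (single-conjunct summit, D-0017)
set_option linter.dupNamespace false

open MeasureTheory Set Metric Filter Topology
open scoped ENNReal

namespace Summit.NavierStokesRegularity.NavierStokesRegularity.Cruxes.ScarEnvelopeTypeI.ZoomDictionary

variable {u : ℝ → (EuclideanSpace ℝ (Fin 3)) → (EuclideanSpace ℝ (Fin 3))} {a : (EuclideanSpace ℝ (Fin 3))} {ν T : ℝ}

section UnitNormalisation

open Literature.Analysis.FluidPDE
variable {u : ℝ → (EuclideanSpace ℝ (Fin 3)) → (EuclideanSpace ℝ (Fin 3))} {p : ℝ → (EuclideanSpace ℝ (Fin 3)) → ℝ} {a : (EuclideanSpace ℝ (Fin 3))} {T : ℝ}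

/-! ### Part G — large satellites: re-extraction and uniqueness of tangent flows

For `e/c₀ < |y'| < 1` a satellite of `ū` at `y'` is a SMALL satellite, at `y'/λ`, of the tangent
flow along `λ L` (`λ = c₀|y'|/e > 1`), which exists along a subsequence by I1 and coincides with
`λ ū(λ²·, λ·)` a.e. near the origin by uniqueness of `L³` limits (tree
`ae_eq_of_tendsto_eLpNorm_sub`).  Inputs: I1 (`ZoomsInBall`, `ZoomsBddU`) and the continuity of
`u` on the open strip (measurability of the zooms for large `k`). -/

/-- Regularity at `(0,y)` passes between fields that agree a.e. on a cylinder `Q_R(0)` with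
`|y| < R`. -/
theorem regPt_congr_ae {ū ū' : ℝ → (EuclideanSpace ℝ (Fin 3)) → (EuclideanSpace ℝ (Fin 3))} {y : (EuclideanSpace ℝ (Fin 3))} {R : ℝ} (hyR : ‖y‖ < R)
    (hae : ∀ᵐ z ∂(volume.restrict (parabolicCylinder R (0 : ℝ × (EuclideanSpace ℝ (Fin 3))))), ū' z.1 z.2 = ū z.1 z.2)
    (h : RegPt ū' y) : RegPt ū y := by
  obtain ⟨r, hr, M, hM⟩ := h
  set r' : ℝ := min r (R - ‖y‖) with hr'
  have hr'0 : 0 < r' := lt_min hr (sub_pos.2 hyR)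
  have hr'r : r' ≤ r := min_le_left _ _
  have hr'R : ‖y‖ + r' ≤ R := by
    have := min_le_right r (R - ‖y‖)
    linarith
  have hr'R' : r' ≤ R := le_trans (le_add_of_nonneg_left (norm_nonneg _)) hr'R
  have hsub1 : parabolicCylinder r' ((0 : ℝ), y) ⊆ parabolicCylinder R (0 : ℝ × (EuclideanSpace ℝ (Fin 3))) :=
    parabolicCylinder_subset_zero (pow_le_pow_left₀ hr'0.le hr'R' 2) hr'R
  have hsub2 : parabolicCylinder r' ((0 : ℝ), y) ⊆ parabolicCylinder r ((0 : ℝ), y) :=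
    parabolicCylinder_mono hr'0.le hr'r _
  refine ⟨r', hr'0, M, ?_⟩
  have h1 := ae_restrict_of_ae_restrict_of_subset hsub1 hae
  have h2 := ae_restrict_of_ae_restrict_of_subset hsub2 hM
  filter_upwards [h1, h2] with z hz1 hz2
  rw [← hz1]
  exact hz2

/-- **No satellite anywhere in the unit ball.**  Under I1's inputs and the continuity of `u` on
the open strip, the small-satellite form of the right-hand side excludes satellites of every
tangent flow at every final-time point `y'` with `0 < |y'| < 1`. -/
theorem regPt_of_noSmallSatellite (hT : 0 < T)
    (hcont : ContinuousOn (Function.uncurry u) (Ioo 0 T ×ˢ univ))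
    (hZ : ZoomsInBall u p a T) (hB : ZoomsBddU u p a T)
    (h : ∀ L ū, TangentU u p a T L ū → ∀ y' : (EuclideanSpace ℝ (Fin 3)), y' ≠ 0 → ‖y'‖ ≤ Real.exp 1 / c₀ → RegPt ū y')
    {L : ℕ → ℝ} {ū : ℝ → (EuclideanSpace ℝ (Fin 3)) → (EuclideanSpace ℝ (Fin 3))} (ht : TangentU u p a T L ū) {y' : (EuclideanSpace ℝ (Fin 3))} (hy0 : y' ≠ 0)
    (hy1 : ‖y'‖ < 1) : RegPt ū y' := by
  by_cases hsmall : ‖y'‖ ≤ Real.exp 1 / c₀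
  · exact h L ū ht y' hy0 hsmall
  push Not at hsmall
  have hc₀ : 0 < c₀ := c₀_pos
  have he : 0 < Real.exp 1 := Real.exp_pos 1
  have hn : 0 < ‖y'‖ := norm_pos_iff.2 hy0
  have hc₀' : c₀ ≠ 0 := hc₀.ne'
  have he' : Real.exp 1 ≠ 0 := he.ne'
  have hn' : ‖y'‖ ≠ 0 := hn.ne'
  -- ## the factor `λ = c₀ |y'| / e > 1`
  set lam : ℝ := c₀ * ‖y'‖ / Real.exp 1 with hlam
  have hlam1 : 1 < lam := by
    rw [hlam, one_lt_div he]
    calc Real.exp 1 = c₀ * (Real.exp 1 / c₀) := by field_simp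
      _ < c₀ * ‖y'‖ := mul_lt_mul_of_pos_left hsmall hc₀
  have hlam0 : 0 < lam := one_pos.trans hlam1
  have hlam' : lam ≠ 0 := hlam0.ne'
  obtain ⟨hpos, hlim, pbar, hR⟩ := ht
  -- ## I1: a tangent flow `ū'` along a subsequence of `λ L`
  have hlimℓ : Tendsto (fun k => lam * L k / c₀) atTop (𝓝 0) := by
    simpa using (hlim.const_mul lam).div_const c₀
  obtain ⟨φ, hφ, ū', ht'⟩ :=
    i1_of_suitableCompactness hZ hB (fun k => lam * L k / c₀)
      (fun k => div_pos (mul_pos hlam0 (hpos k)) hc₀) hlimℓ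
  have ht'' : TangentU u p a T (fun k => lam * L (φ k)) ū' := by
    have e : (fun k => c₀ * ((fun k => lam * L k / c₀) ∘ φ) k) = fun k => lam * L (φ k) := by
      funext k
      simp only [Function.comp_apply]
      field_simp
    rw [← e]
    exact ht'
  -- ## the small satellite of `ū'`
  have hy'' : ‖lam⁻¹ • y'‖ = Real.exp 1 / c₀ := by
    rw [norm_smul, norm_inv, Real.norm_of_nonneg hlam0.le, hlam]
    field_simp
  have hreg' : RegPt ū' (lam⁻¹ • y') :=
    h _ _ ht'' _ (smul_ne_zero (inv_ne_zero hlam') hy0) hy''.le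
  -- ## the comparison cylinder `Q_{θ/λ}(0)`, `|y'| < θ < 1`
  set θ : ℝ := (1 + ‖y'‖) / 2 with hθ
  have hθ1 : θ < 1 := by rw [hθ]; linarith
  have hθ0 : 0 < θ := by rw [hθ]; linarith
  have hθy : ‖y'‖ < θ := by rw [hθ]; linarith
  set R'' : ℝ := θ / lam with hR''
  have hR''0 : 0 < R'' := div_pos hθ0 hlam0
  have hR''1 : R'' < 1 := by
    rw [hR'', div_lt_one hlam0]
    exact hθ1.trans hlam1
  have hlamR : lam * R'' = θ := by rw [hR'']; field_simp
  obtain ⟨pbar', hR'⟩ := ht''.2.2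
  obtain ⟨-, hM', hconv', -⟩ := hR' R'' ⟨hR''0, hR''1⟩
  obtain ⟨-, hMθ, hconvθ, -⟩ := hR θ ⟨hθ0, hθ1⟩
  -- ## the zoomed-in tangent flow `ū_λ = λ ū(λ²·, λ·)` and its `L³` convergence on `Q_{R''}(0)`
  set ūl : ℝ → (EuclideanSpace ℝ (Fin 3)) → (EuclideanSpace ℝ (Fin 3)) := lam • stPull (lam ^ 2) lam (0 : ℝ) (0 : (EuclideanSpace ℝ (Fin 3))) ū with hūl
  have e : ∀ k, Function.uncurry (zoom u a T (lam * L (φ k))) - Function.uncurry ūl =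
      Function.uncurry (lam • stPull (lam ^ 2) lam (0 : ℝ) (0 : (EuclideanSpace ℝ (Fin 3))) (zoom u a T (L (φ k)) - ū)) := by
    intro k
    funext z
    obtain ⟨s, y⟩ := z
    simp only [hūl, Pi.sub_apply, Function.uncurry_apply_pair, smul_stPull_apply, zoom_mul,
      zero_add, smul_sub]
  have hnorm : ∀ k, eLpNorm (Function.uncurry (zoom u a T (lam * L (φ k))) - Function.uncurry ūl) 3
        (volume.restrict (parabolicCylinder R'' (0 : ℝ × (EuclideanSpace ℝ (Fin 3))))) =
      ‖lam‖ₑ * (ENNReal.ofReal (lam ^ 2 * lam ^ 3)⁻¹) ^ (1 / (3 : ℝ≥0∞).toReal) *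
        eLpNorm (Function.uncurry (zoom u a T (L (φ k))) - Function.uncurry ū) 3
          (volume.restrict (parabolicCylinder θ (0 : ℝ × (EuclideanSpace ℝ (Fin 3))))) := by
    intro k
    have h1 := eLpNorm_uncurry_zoom hlam0 lam (zoom u a T (L (φ k)) - ū) θ
      (q := (3 : ℝ≥0∞)) (by norm_num) (by norm_num)
    rw [← hR''] at h1
    rw [e k, h1]
    rfl
  have hconv2 : Tendsto (fun k => eLpNorm (Function.uncurry (zoom u a T (lam * L (φ k))) -
      Function.uncurry ūl) 3 (volume.restrict (parabolicCylinder R'' (0 : ℝ × (EuclideanSpace ℝ (Fin 3)))))) atTop (𝓝 0) := by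
    simp_rw [hnorm]
    have hK : ‖lam‖ₑ * (ENNReal.ofReal (lam ^ 2 * lam ^ 3)⁻¹) ^ (1 / (3 : ℝ≥0∞).toReal) ≠ ⊤ :=
      ENNReal.mul_ne_top enorm_ne_top
        (ENNReal.rpow_ne_top_of_nonneg (by positivity) ENNReal.ofReal_ne_top)
    have h2 := ENNReal.Tendsto.const_mul (hconvθ.comp hφ.tendsto_atTop) (Or.inr hK)
    simpa using h2
  -- ## measurability of the zooms on `Q_{R''}(0)` for large `k`, and uniqueness of limits
  have hlim2 : Tendsto (fun k => lam * L (φ k)) atTop (𝓝 0) := by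
    simpa using (hlim.comp hφ.tendsto_atTop).const_mul lam
  obtain ⟨N, hN⟩ := eventually_atTop.1 (eventually_sq_mul_lt hlim2 hT (R'' ^ 2))
  have hQ : (Ioo (-(R'' ^ 2)) 0 ×ˢ ball (0 : (EuclideanSpace ℝ (Fin 3))) R'') = parabolicCylinder R'' (0 : ℝ × (EuclideanSpace ℝ (Fin 3))) := by
    rw [Ioo_prod_ball_eq_parabolicCylinder, Prod.mk_zero_zero]
  have hF : ∀ j, AEStronglyMeasurable (Function.uncurry (zoom u a T (lam * L (φ (j + N)))))
      (volume.restrict (parabolicCylinder R'' (0 : ℝ × (EuclideanSpace ℝ (Fin 3))))) := by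
    intro j
    rw [← hQ]
    exact (continuousOn_zoom hcont (mul_pos hlam0 (hpos _)) 0 (hN (j + N) (by omega)))
      |>.aestronglyMeasurable ((measurableSet_Ioo.prod measurableSet_ball))
  have hf : AEStronglyMeasurable (Function.uncurry ū')
      (volume.restrict (parabolicCylinder R'' (0 : ℝ × (EuclideanSpace ℝ (Fin 3))))) := hM'.1
  have hg : AEStronglyMeasurable (Function.uncurry ūl)
      (volume.restrict (parabolicCylinder R'' (0 : ℝ × (EuclideanSpace ℝ (Fin 3))))) := by
    have h1 := (memLp_comp_zoom hlam0 (by norm_num) (by norm_num) hMθ).const_smul lam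
    rw [← hR''] at h1
    have e1 : Function.uncurry ūl = lam • (Function.uncurry ū ∘ stAffine (lam ^ 2) lam (0 : ℝ) (0 : (EuclideanSpace ℝ (Fin 3)))) := by
      funext z; rfl
    rw [e1]
    exact h1.1
  have hae : Function.uncurry ū' =ᵐ[volume.restrict (parabolicCylinder R'' (0 : ℝ × (EuclideanSpace ℝ (Fin 3))))]
      Function.uncurry ūl :=
    ae_eq_of_tendsto_eLpNorm_sub (r := (3 : ℝ≥0∞)) (by norm_num) hF hf hg
      (hconv'.comp (tendsto_add_atTop_nat N)) (hconv2.comp (tendsto_add_atTop_nat N))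
  -- ## conclusion
  have hyR : ‖lam⁻¹ • y'‖ < R'' := by
    rw [norm_smul, norm_inv, Real.norm_of_nonneg hlam0.le, hR'', inv_mul_eq_div]
    exact div_lt_div_of_pos_right hθy hlam0
  have hregl : RegPt ūl (lam⁻¹ • y') :=
    regPt_congr_ae hyR (hae.mono fun z hz => hz) hreg'
  exact regPt_of_zoomIn hlam0 hregl

/-- **SD, read at EVERY satellite in the unit ball** (ν = 1): the annular cubic slice budget at `a`
holds iff every tangent flow at `(a, T)` is essentially bounded near every final-time point
`(0, y')`, `0 < |y'| < 1`. -/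
theorem budgetAt_iff_noSatelliteInBall (hT : 0 < T)
    (hcont : ContinuousOn (Function.uncurry u) (Ioo 0 T ×ˢ univ))
    (hTI : IsTypeIBlowup u T) (hZ : ZoomsInBall u p a T) (hB : ZoomsBddU u p a T) :
    BudgetAt 1 T u a ↔ ∀ L ū, TangentU u p a T L ū →
      ∀ y' : (EuclideanSpace ℝ (Fin 3)), y' ≠ 0 → ‖y'‖ < 1 → RegPt ū y' := by
  rw [budgetAt_iff_noSmallSatellite hT hcont hTI hZ hB]
  refine ⟨fun h L ū ht y' hy0 hy1 => regPt_of_noSmallSatellite hT hcont hZ hB h ht hy0 hy1,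
    fun h L ū ht y' hy0 hy1 => h L ū ht y' hy0 (hy1.trans_lt ?_)⟩
  rw [div_lt_one c₀_pos]
  have := sixteen_lt_c₀
  have h3 : Real.exp 1 < 3 := lt_trans Real.exp_one_lt_d9 (by norm_num)
  linarith

/-- The same with the `u`-side inputs supplied by the Leray continuation (ν = 1). -/
theorem budgetAt_iff_noSatelliteInBall_of_typeI (hT : 0 < T)
    (hcl : IsClassicalNSSolutionOn (Ico 0 T) 1 0 u p) (hLH : IsLerayHopfOn T 1 0 (u 0) u)
    (hdec : HasRapidSpatialDecay (u 0)) (hTI : IsTypeIBlowup u T) :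
    BudgetAt 1 T u a ↔ ∀ q : ℝ → (EuclideanSpace ℝ (Fin 3)) → ℝ, ZoomsInBall u q a T → ZoomsBddU u q a T →
      ∀ L ū, TangentU u q a T L ū → ∀ y' : (EuclideanSpace ℝ (Fin 3)), y' ≠ 0 → ‖y'‖ < 1 → RegPt ū y' := by
  have hcont := continuousOn_of_classical hcl
  constructor
  · intro hB q hZ hBd
    exact (budgetAt_iff_noSatelliteInBall hT hcont hTI hZ hBd).1 hB
  · intro h
    obtain ⟨q, hZ, hBd⟩ := exists_pressure_zooms_of_typeI (a := a) hT hcl hLH hdec hTI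
    exact (budgetAt_iff_noSatelliteInBall hT hcont hTI hZ hBd).2 (h q hZ hBd)

end UnitNormalisation

end Summit.NavierStokesRegularity.NavierStokesRegularity.Cruxes.ScarEnvelopeTypeI.ZoomDictionary
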